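import Mathlib
import HarnessLib
import Literature.Analysis.FluidPDE.Tao2016AveragedNS.LocalCascadeSolutions
import Literature.Analysis.FluidPDE.Tao2016AveragedNS.RenormalisedCascadeWaves
import Literature.Analysis.FluidPDE.Tao2016AveragedNS.ViscousEternalSolutions
import Literature.Analysis.FluidPDE.Tao2016AveragedNS.SelfSimilarCascadeBlowup
import Literature.Analysis.FluidPDE.Tao2016AveragedNS.BoundedEternalSolutions
import Summits.NavierStokesRegularity.NavierStokesRegularity.Theorems.TaoLadderRungTwoBreakNoSurvivingEternalViscBddOneSurvivalLoud

/-!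
# Crux K1(1) `TaoLadderRungTwoBreak.NoSurvivingDSSOne` (stmt-NavierStokesRegularity-20205): an (S₁)-SURVIVING
# admissible DSS wave of a strong-orthant table is LOUD ON EVERY PROFILE OF THE ORBIT — by name on the item's
# own binders (`IsDSSWave`, `Surviving 1`), and for the dyadic member

MODEL lattice ODEs only (Tao 2016 §4 in the self-similar log-time variables of §6.4); nothing in this file
is a statement about the Navier–Stokes equations, and no summit or rung LEAF is proved by it
(`--supports stmt-NavierStokesRegularity-20205 --as helper`).  `C_A = fluxConst α`, `Λ = bigLam ε₀`.

The item ⟨20205⟩ quantifies over admissible DSS waves `Φ` (`IsDSSWave ε₀ α π T Φ`) that are (S₁)-surviving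
(`Surviving 1 ε₀ T`).  For such a wave on a strong-orthant table (pure Katz–Pavlović network; in particular on
`dyadicTable`), the embedded eternal solution `dssEmbed π T Φ r₀` of a non-trivial profile `r₀` is forward
(S₁)-surviving (tree `eternalSurvivingFwd_dssEmbed`), uniformly bounded (`uniformBound_dssEmbed`), admissible
(`IsDSSWave.isEternal_dssEmbed`) with per-shell actions `≤ ∫ Σ_r ‖Φ_r‖` — so `…SurvivalLoud` applies:

* `dss_action_le_mass` — the per-shell action of the embedded solution is at most the total mass `∫ sMass Φ`;
* `orthant_dss_surviving_orbit_loud` — EVERY profile in the `π`-orbit of a non-trivial profile `r₀` reaches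
  amplitude `> q⋆ = min(3/(16 C_A² (1+ε₀) (∫ sMass Φ + 1)), 1/(4Λ(C_A+1)))` somewhere: a surviving DSS wave of a
  pure Katz–Pavlović network cannot carry a uniformly faint profile in the orbit of a lit one;
* `dyadic_dss_surviving_orbit_loud` — the same on `dyadicTable`, no hypothesis on the table left.

Compare the tree's amplitude floor for surviving waves (`…WeightedGrowth`: `sup_r sup_x ‖Φ_r(x)‖ ≳ 1/(5C_Aε₀)`, one
profile somewhere); here EVERY profile of the orbit is loud, at an `ε₀`-independent level set by the total mass.
HONEST LABEL: structure lemma; `stub_eternalLiouville` and ⟨20205⟩ stay OPEN; rung 0.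
-/

noncomputable section

-- the summit and its single sub-problem share the name (CONVENTIONS §1)
set_option linter.dupNamespace false

namespace Summit.NavierStokesRegularity.NavierStokesRegularity.Theorems.NoSurvivingDSSOne.LeadingEdge

open Set Filter Topology MeasureTheory
open scoped RealInnerProductSpace
open Literature.Analysis.FluidPDE Literature.Analysis.FluidPDE.TaoCascade
open Summit.NavierStokesRegularity.NavierStokesRegularity.Theorems.NoSurvivingEternalViscBddOne.TailBarrier
open Summit.NavierStokesRegularity.NavierStokesRegularity.Theorems.WakeRatchetOrthant
  (quasiPositive_iff_strongOrthant quasiPositive_dyadicTable)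

variable {ρ : Type*} [Fintype ρ] {m : ℕ} {ε₀ : ℝ} {α : Fin m → Fin m → Fin m → ℤ × ℤ × ℤ → ℝ}
  {π : Equiv.Perm ρ} {T : ℝ} {Φ : ρ → ℝ → Em m}

/-- **The per-shell action of the eternal solution carried by a DSS wave is at most the total mass**
`∫ Σ_r ‖Φ_r‖` (translation invariance of the integral; `‖Φ_r‖ ≤ sMass Φ`).
[cite: Tao2016AveragedNS, §4 Lemma 4.1 (4.8); cell vocabulary `dssEmbed`, `sMass`] -/
theorem dss_action_le_mass (hW : IsDSSWave ε₀ α π T Φ) (r₀ : ρ) (n : ℤ) :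
    ∫ σ, ‖dssEmbed π T Φ r₀ n σ‖ ≤ ∫ σ, sMass Φ σ := by
  have hcont : Continuous (Φ ((π ^ n) r₀)) :=
    continuous_iff_continuousAt.2 fun x => (hW.wave ((π ^ n) r₀) x).continuousAt
  have hmeas : AEStronglyMeasurable (fun σ => ‖dssEmbed π T Φ r₀ n σ‖) volume := by
    have : Continuous fun σ => ‖dssEmbed π T Φ r₀ n σ‖ :=
      (hcont.comp (continuous_id.sub continuous_const)).norm
    exact this.aestronglyMeasurable
  have hdom : Integrable (fun σ => sMass Φ (σ - n * T)) := hW.mass.comp_sub_right (n * T)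
  have hint : Integrable (fun σ => ‖dssEmbed π T Φ r₀ n σ‖) := by
    refine hdom.mono' hmeas (Filter.Eventually.of_forall fun σ => ?_)
    rw [norm_norm]
    exact norm_le_sMass Φ _ _
  calc ∫ σ, ‖dssEmbed π T Φ r₀ n σ‖ ≤ ∫ σ, sMass Φ (σ - n * T) :=
        integral_mono hint hdom fun σ => norm_le_sMass Φ _ _
    _ = ∫ σ, sMass Φ σ := integral_sub_right_eq_self (fun σ => sMass Φ σ) (n * T)

/-- **An (S₁)-surviving admissible DSS wave of a strong-orthant table is loud on every profile of the orbit.**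
Let `Φ` be an admissible DSS wave (`IsDSSWave ε₀ α π T Φ`, `ε₀ > 0`) of a cancelling strong-orthant table (feeds
`(A y)_i ≥ 0`, in-shell components `(Q x)_i ≥ 0` on `{x_i = 0}`, diagonal back-reaction) that is (S₁)-surviving
(`Surviving 1 ε₀ T`), and `r₀` a profile with `Φ_{r₀}(x₀) ≠ 0`.  Then for every `j : ℤ` the profile `π^j r₀`
reaches amplitude `> min(3/(16 C_A² (1+ε₀) (∫ sMass Φ + 1)), 1/(4Λ(C_A+1)))` at some point.
[cite: Tao2016AveragedNS, §1.2, §4 Lemma 4.1 (4.8), Thm. 4.2 (statement shape), §6.4; cell predicates `IsDSSWave`, `Surviving`] -/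
theorem orthant_dss_surviving_orbit_loud (hε : 0 < ε₀) (hW : IsDSSWave ε₀ α π T Φ)
    (hc : IsCancellingCoeff α)
    (hA : ∀ (i : Fin m) (y : Em m), 0 ≤ tableA α y i)
    (hQ : ∀ (i : Fin m) (x : Em m), x i = 0 → 0 ≤ tableQ α x i)
    (hBk : ∀ (i : Fin m) (z x : Em m), x i = 0 → tableB α z x i = 0)
    (hS : Surviving 1 ε₀ T) {r₀ : ρ} {x₀ : ℝ} (hne : Φ r₀ x₀ ≠ 0) :
    ∀ j : ℤ, ∃ x : ℝ,
      min (3 / (16 * fluxConst α ^ 2 * (1 + ε₀) * ((∫ σ, sMass Φ σ) + 1)))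
          (1 / (4 * bigLam ε₀ * (fluxConst α + 1))) < ‖Φ ((π ^ j) r₀) x‖ := by
  have hE : IsEternalVisc ε₀ 0 α (dssEmbed π T Φ r₀) :=
    (hW.isEternal_dssEmbed r₀).isEternalVisc
  have hU : UniformBound (dssEmbed π T Φ r₀) := uniformBound_dssEmbed hW r₀
  have hSurv : EternalSurvivingFwd 1 ε₀ (dssEmbed π T Φ r₀) :=
    eternalSurvivingFwd_dssEmbed hε hW.delay_pos hS hne
  have hmass0 : 0 ≤ ∫ σ, sMass Φ σ := integral_nonneg fun σ => sMass_nonneg Φ σ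
  have hMact : 0 < (∫ σ, sMass Φ σ) + 1 := by linarith
  have hact : ∀ n : ℤ, ∫ s, ‖dssEmbed π T Φ r₀ n s‖ ≤ (∫ σ, sMass Φ σ) + 1 :=
    fun n => (dss_action_le_mass hW r₀ n).trans (by linarith)
  intro j
  obtain ⟨s, hs⟩ := orthant_survivingFwd_loud_everywhere hε hE hc hA hQ hBk hU hMact hact hSurv j
  exact ⟨s - j * T, by simpa only [dssEmbed] using hs⟩

/-- **The dyadic member: an (S₁)-surviving admissible DSS wave of the Katz–Pavlović chain is loud on every
profile of the orbit of a lit profile** — `ε₀ > 0`, no hypothesis on the table left.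
[cite: Tao2016AveragedNS, §1.2 (the dyadic Katz–Pavlović model), §4 Lemma 4.1 (4.8), §6.4] -/
theorem dyadic_dss_surviving_orbit_loud (hε : 0 < ε₀) {π : Equiv.Perm ρ} {T : ℝ} {Φ : ρ → ℝ → Em 4}
    (hW : IsDSSWave ε₀ dyadicTable π T Φ) (hS : Surviving 1 ε₀ T) {r₀ : ρ} {x₀ : ℝ}
    (hne : Φ r₀ x₀ ≠ 0) :
    ∀ j : ℤ, ∃ x : ℝ,
      min (3 / (16 * fluxConst dyadicTable ^ 2 * (1 + ε₀) * ((∫ σ, sMass Φ σ) + 1)))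
          (1 / (4 * bigLam ε₀ * (fluxConst dyadicTable + 1))) < ‖Φ ((π ^ j) r₀) x‖ := by
  obtain ⟨hA, hQ, hBk⟩ := (quasiPositive_iff_strongOrthant dyadicTable).1 quasiPositive_dyadicTable
  have hα : InTableClass 2 dyadicTable := inTableClass_dyadicTable le_rfl
  exact orthant_dss_surviving_orbit_loud hε hW hα.2.1 hA hQ hBk hS hne

end Summit.NavierStokesRegularity.NavierStokesRegularity.Theorems.NoSurvivingDSSOne.LeadingEdge

end
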